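import Literature.NumberTheory.Rogawski1990.AdelicStableOrbitalIntegral
import Literature.NumberTheory.Rogawski1990.AdelicStableConjugacyG
import Literature.NumberTheory.Rogawski1990.EndoscopicClassTransfer
import HarnessLib

/-!
# The adelic stable class sets `𝒞_𝐀(γ₀)`, `𝒞′_𝐀(γ_H)`, `𝒞_𝐀(γ_H)` depend only on the STABLE CLASS of the rational representative
(Rogawski, *Automorphic Representations of Unitary Groups in Three Variables* (1990), §3.3 p. 21, §4.3 p. 43, §5.4 pp. 71–73)

Topic `NumberTheory/Rogawski1990`; namespace `Literature.NumberTheory.Rogawski1990`; THEOREMS ONLY (no definition, no instance, no named fact, no `sorry`).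
Representative invariance of the three adelic stable class sets of the stabilised geometric side — ★ `MatchingAdeleG.classes L H γ₀` (the `G(𝐀)`-classes
matching a rational `γ₀ ∈ U(H)(L⁺)`), ★ `adelicStableClassesOverH L γ_H` (the `H(𝐀)`-classes stably matching `γ_H`), ★ `adelicStableClassesOver L H′ γ_H`
(the `G′(𝐀)`-classes norm-matching `γ_H`) — under STABLE conjugacy of the rational representative (`γ₀ ∼_st γ₀′` in `U(H)(L⁺)`, resp.
`γ_H ∼_st γ_H′` in `H(L⁺)`, ★ `IsStablyConj` ∕ ★ `IsStablyConjH`), together with the induced equalities of the adelic stable orbital sums ★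
`adelicStableOrbitalIntegralG` ∕ `…H` ∕ `…G′` (every measure family, every test function).  WHY: the ED 1.19c pins (xii″)∕(xiii″) of the ENGINE line
quantify over EVERY rational representative of a stable class `𝒪` while the anchored kit evaluates at `Quotient.out`; these lemmas are the bridge
(read through ★ `stableClassOf_eq_iff`).  Proofs: a global stable conjugacy localises at every finite place (★ `corresponds_toLocal_toAdelic`) and at
infinity (★ `corresponds_cmRationalToArch`), and the matching predicates are invariant under stable conjugacy of the base (★ `Corresponds.of_isStablyConj_left`,
★ `IsStablyConjH.trans`, ★ `EndoMatches.of_isStablyConjH_left`).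

* §1 `MatchingAdeleG.classes_eq_of_isStablyConj`, `adelicStableOrbitalIntegralG_eq_of_isStablyConj`.
* §2 `adelicStableClassesOverH_eq_of_isStablyConjH`, `adelicStableOrbitalIntegralH_eq_of_isStablyConjH`.
* §3 `adelicStableClassesOver_eq_of_isStablyConjH`, `adelicStableOrbitalIntegralG'_eq_of_isStablyConjH`.

## References
* J. D. Rogawski, *Automorphic Representations of Unitary Groups in Three Variables*, Ann. of Math. Stud. 123 (1990), §3.3 p. 21, §4.3 p. 43, §5.4
  pp. 71–73 (print) [Rogawski1990].
-/

set_option autoImplicit false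

noncomputable section

open NumberField IsDedekindDomain

namespace Literature.NumberTheory.Rogawski1990

open Literature.NumberTheory.Automorphic

variable (L : Type) [Field L] [NumberField L] [IsCMField L]

/-! ## §1 `G`-side: `𝒞_𝐀(γ₀)` over the split form -/

section G

variable (H : Matrix (Fin 3) (Fin 3) L)

/-- Stably conjugate base points have the same matching adèles: transport of ★ `MatchingAdeleG` along `γ₀ ∼_st γ₀′` (the correspondences
`(γ₀)_v ↔ g_v`, `γ₀ ⊗ 1 ↔ g_∞` depend only on the stable class of `γ₀`: ★ `corresponds_toLocal_toAdelic`, ★ `corresponds_cmRationalToArch`,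
★ `Corresponds.of_isStablyConj_left`). [cite: Rogawski1990, §3.3 p. 21; §5.4 p. 72] -/
theorem MatchingAdeleG.exists_adele_eq_of_isStablyConj {γ₀ γ₀' : (UnitaryGroup.cmDatum L 3 H).Rational}
    (h : IsStablyConj (cmConjRingHom L) H γ₀ γ₀') (p : MatchingAdeleG L H γ₀) : ∃ q : MatchingAdeleG L H γ₀', q.adele = p.adele := by
  have h1 : ∀ v : HeightOneSpectrum (𝓞 ↥(maximalRealSubfield L)),
      Corresponds (UnitaryGroup.conjLocal L (IsCMField.complexConj L) v)
        ((UnitaryGroup.adelicForm L 3 H).map (UnitaryGroup.adeleToLocal L v))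
        ((UnitaryGroup.adelicForm L 3 (Matrix.of fun i j : Fin 3 => if i.val + j.val + 1 = 3 then (1 : L) else 0)).map (UnitaryGroup.adeleToLocal L v))
        ((UnitaryGroup.cmDatum L 3 H).toLocal v ((UnitaryGroup.cmDatum L 3 H).toAdelic γ₀'))
        ((UnitaryGroup.cmDatum L 3 (Matrix.of fun i j : Fin 3 => if i.val + j.val + 1 = 3 then (1 : L) else 0)).toLocal v p.adele) :=
    fun v => (p.corresponds_toLocal v).of_isStablyConj_left (corresponds_toLocal_toAdelic h v)
  have h2 : Corresponds (UnitaryGroup.conjMixed (↥(maximalRealSubfield L)) L (IsCMField.complexConj L)) (UnitaryGroup.archFormOf L 3 H)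
      (UnitaryGroup.archFormOf L 3 (Matrix.of fun i j : Fin 3 => if i.val + j.val + 1 = 3 then (1 : L) else 0)) (cmRationalToArch L 3 H γ₀') p.arch :=
    p.corresponds_arch.of_isStablyConj_left (corresponds_cmRationalToArch h)
  -- `rfl` stated at `p.1` so that the kernel never compares `adele ⟨p.1, …⟩` with `adele p` argument-wise
  exact ⟨⟨p.1, h1, h2⟩, (rfl : p.1 = p.1)⟩

/-- **`𝒞_𝐀(γ₀) = 𝒞_𝐀(γ₀′)` for `γ₀ ∼_st γ₀′`**: the set of `G(𝐀)`-classes of adèles matching a rational `γ₀ ∈ U(H)(L⁺)` depends only on the stable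
class of `γ₀`. [cite: Rogawski1990, §5.4 p. 72] -/
theorem MatchingAdeleG.classes_eq_of_isStablyConj {γ₀ γ₀' : (UnitaryGroup.cmDatum L 3 H).Rational}
    (h : IsStablyConj (cmConjRingHom L) H γ₀ γ₀') : MatchingAdeleG.classes L H γ₀ = MatchingAdeleG.classes L H γ₀' := by
  refine Set.ext fun c => ⟨?_, ?_⟩
  · rintro ⟨p, rfl⟩
    obtain ⟨q, hq⟩ := MatchingAdeleG.exists_adele_eq_of_isStablyConj L H h p
    exact ⟨q, by show ConjClasses.mk q.adele = ConjClasses.mk p.adele; rw [hq]⟩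
  · rintro ⟨p, rfl⟩
    obtain ⟨q, hq⟩ := MatchingAdeleG.exists_adele_eq_of_isStablyConj L H h.symm p
    exact ⟨q, by show ConjClasses.mk q.adele = ConjClasses.mk p.adele; rw [hq]⟩

/-- **`Φ^{st,𝐀}_G(γ₀, m, f) = Φ^{st,𝐀}_G(γ₀′, m, f)` for `γ₀ ∼_st γ₀′`** (every class-indexed family `m`, every `f`): the adelic stable orbital sum ★
`adelicStableOrbitalIntegralG` is a function of the stable class. [cite: Rogawski1990, §5.4 (5.4.3) pp. 72–73] -/
theorem adelicStableOrbitalIntegralG_eq_of_isStablyConj {γ₀ γ₀' : (UnitaryGroup.cmDatum L 3 H).Rational}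
    (h : IsStablyConj (cmConjRingHom L) H γ₀ γ₀')
    [∀ g : (UnitaryGroup.cmDatum L 3 (Matrix.of fun i j : Fin 3 => if i.val + j.val + 1 = 3 then (1 : L) else 0)).Adelic,
      MeasurableSpace ((UnitaryGroup.cmDatum L 3 (Matrix.of fun i j : Fin 3 => if i.val + j.val + 1 = 3 then (1 : L) else 0)).Adelic ⧸
        Subgroup.centralizer ({g} : Set (UnitaryGroup.cmDatum L 3 (Matrix.of fun i j : Fin 3 => if i.val + j.val + 1 = 3 then (1 : L) else 0)).Adelic))]
    (m : OrbitalMeasureFamily (UnitaryGroup.cmDatum L 3 (Matrix.of fun i j : Fin 3 => if i.val + j.val + 1 = 3 then (1 : L) else 0)).Adelic)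
    (f : (UnitaryGroup.cmDatum L 3 (Matrix.of fun i j : Fin 3 => if i.val + j.val + 1 = 3 then (1 : L) else 0)).Adelic → ℂ) :
    adelicStableOrbitalIntegralG L H γ₀ m f = adelicStableOrbitalIntegralG L H γ₀' m f := by
  unfold adelicStableOrbitalIntegralG
  rw [MatchingAdeleG.classes_eq_of_isStablyConj L H h]

end G

/-! ## §2 `H`-side: `𝒞′_𝐀(γ_H)` -/

section Hside

/-- A global stable conjugacy `γ_H ∼_st γ_H′` in `H(L⁺)` localises at every finite place. [cite: Rogawski1990, §3.1 p. 19; §4.3 p. 43] -/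
theorem isLocalStablyConjH_rationalComponent_of_isStablyConjH
    {γH γH' : (UnitaryGroup.cmDatum L 2 (Matrix.of fun i j : Fin 2 => if i.val + j.val + 1 = 2 then (1 : L) else 0)).Rational ×
      (UnitaryGroup.cmDatum L 1 (Matrix.of fun i j : Fin 1 => if i.val + j.val + 1 = 1 then (1 : L) else 0)).Rational}
    (h : IsStablyConjH (cmConjRingHom L) (Matrix.of fun i j : Fin 2 => if i.val + j.val + 1 = 2 then (1 : L) else 0)
      (Matrix.of fun i j : Fin 1 => if i.val + j.val + 1 = 1 then (1 : L) else 0) γH γH')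
    (v : HeightOneSpectrum (𝓞 ↥(maximalRealSubfield L))) :
    IsLocalStablyConjH L v (rationalComponent L γH v) (rationalComponent L γH' v) :=
  ⟨corresponds_toLocal_toAdelic h.1 v, corresponds_toLocal_toAdelic h.2 v⟩

/-- A global stable conjugacy `γ_H ∼_st γ_H′` in `H(L⁺)` passes to `H_∞`. [cite: Rogawski1990, §3.1 p. 19; §4.3 p. 43] -/
theorem isArchStablyConjH_rationalArch_of_isStablyConjH
    {γH γH' : (UnitaryGroup.cmDatum L 2 (Matrix.of fun i j : Fin 2 => if i.val + j.val + 1 = 2 then (1 : L) else 0)).Rational ×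
      (UnitaryGroup.cmDatum L 1 (Matrix.of fun i j : Fin 1 => if i.val + j.val + 1 = 1 then (1 : L) else 0)).Rational}
    (h : IsStablyConjH (cmConjRingHom L) (Matrix.of fun i j : Fin 2 => if i.val + j.val + 1 = 2 then (1 : L) else 0)
      (Matrix.of fun i j : Fin 1 => if i.val + j.val + 1 = 1 then (1 : L) else 0) γH γH') :
    IsArchStablyConjH L (rationalArch L γH) (rationalArch L γH') :=
  ⟨corresponds_cmRationalToArch h.1, corresponds_cmRationalToArch h.2⟩

/-- Stably conjugate base points have the same `H`-matching adèles (★ `MatchingAdeleH`; ★ `IsStablyConjH.trans`).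
[cite: Rogawski1990, §3.3 p. 21; §5.4 p. 72] -/
theorem MatchingAdeleH.exists_adele_eq_of_isStablyConjH
    {γH γH' : (UnitaryGroup.cmDatum L 2 (Matrix.of fun i j : Fin 2 => if i.val + j.val + 1 = 2 then (1 : L) else 0)).Rational ×
      (UnitaryGroup.cmDatum L 1 (Matrix.of fun i j : Fin 1 => if i.val + j.val + 1 = 1 then (1 : L) else 0)).Rational}
    (h : IsStablyConjH (cmConjRingHom L) (Matrix.of fun i j : Fin 2 => if i.val + j.val + 1 = 2 then (1 : L) else 0)
      (Matrix.of fun i j : Fin 1 => if i.val + j.val + 1 = 1 then (1 : L) else 0) γH γH')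
    (p : MatchingAdeleH L γH) : ∃ q : MatchingAdeleH L γH', q.adele = p.adele := by
  have h1 : ∀ v : HeightOneSpectrum (𝓞 ↥(maximalRealSubfield L)), IsLocalStablyConjH L v (rationalComponent L γH' v)
      ((UnitaryGroup.cmDatum L 2 (Matrix.of fun i j : Fin 2 => if i.val + j.val + 1 = 2 then (1 : L) else 0)).toLocal v p.adele.1,
        (UnitaryGroup.cmDatum L 1 (Matrix.of fun i j : Fin 1 => if i.val + j.val + 1 = 1 then (1 : L) else 0)).toLocal v p.adele.2) :=
    fun v => (isLocalStablyConjH_rationalComponent_of_isStablyConjH L h v).symm.trans (p.2.1 v)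
  have h2 : IsArchStablyConjH L (rationalArch L γH')
      (UnitaryGroup.archPart (↥(maximalRealSubfield L)) L (IsCMField.complexConj L) 2 (Matrix.of fun i j : Fin 2 => if i.val + j.val + 1 = 2 then (1 : L) else 0) p.adele.1,
        UnitaryGroup.archPart (↥(maximalRealSubfield L)) L (IsCMField.complexConj L) 1 (Matrix.of fun i j : Fin 1 => if i.val + j.val + 1 = 1 then (1 : L) else 0) p.adele.2) :=
    (isArchStablyConjH_rationalArch_of_isStablyConjH L h).symm.trans p.2.2
  -- `rfl` stated at `p.1` so that the kernel never compares `adele ⟨p.1, …⟩` with `adele p` argument-wise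
  exact ⟨⟨p.1, h1, h2⟩, (rfl : p.1 = p.1)⟩

/-- **`𝒞′_𝐀(γ_H) = 𝒞′_𝐀(γ_H′)` for `γ_H ∼_st γ_H′` in `H(L⁺)`.** [cite: Rogawski1990, §5.4 p. 72] -/
theorem adelicStableClassesOverH_eq_of_isStablyConjH
    {γH γH' : (UnitaryGroup.cmDatum L 2 (Matrix.of fun i j : Fin 2 => if i.val + j.val + 1 = 2 then (1 : L) else 0)).Rational ×
      (UnitaryGroup.cmDatum L 1 (Matrix.of fun i j : Fin 1 => if i.val + j.val + 1 = 1 then (1 : L) else 0)).Rational}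
    (h : IsStablyConjH (cmConjRingHom L) (Matrix.of fun i j : Fin 2 => if i.val + j.val + 1 = 2 then (1 : L) else 0)
      (Matrix.of fun i j : Fin 1 => if i.val + j.val + 1 = 1 then (1 : L) else 0) γH γH') :
    adelicStableClassesOverH L γH = adelicStableClassesOverH L γH' := by
  refine Set.ext fun c => ⟨?_, ?_⟩
  · rintro ⟨p, rfl⟩
    obtain ⟨q, hq⟩ := MatchingAdeleH.exists_adele_eq_of_isStablyConjH L h p
    exact ⟨q, by show ConjClasses.mk q.adele = ConjClasses.mk p.adele; rw [hq]⟩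
  · rintro ⟨p, rfl⟩
    obtain ⟨q, hq⟩ := MatchingAdeleH.exists_adele_eq_of_isStablyConjH L h.symm p
    exact ⟨q, by show ConjClasses.mk q.adele = ConjClasses.mk p.adele; rw [hq]⟩

/-- **`Φ^{st,𝐀}_H(γ_H, m_H, f^H) = Φ^{st,𝐀}_H(γ_H′, m_H, f^H)` for `γ_H ∼_st γ_H′`** (★ `adelicStableOrbitalIntegralH`).
[cite: Rogawski1990, §5.4 Prop. 5.4.1 p. 72] -/
theorem adelicStableOrbitalIntegralH_eq_of_isStablyConjH
    {γH γH' : (UnitaryGroup.cmDatum L 2 (Matrix.of fun i j : Fin 2 => if i.val + j.val + 1 = 2 then (1 : L) else 0)).Rational ×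
      (UnitaryGroup.cmDatum L 1 (Matrix.of fun i j : Fin 1 => if i.val + j.val + 1 = 1 then (1 : L) else 0)).Rational}
    (h : IsStablyConjH (cmConjRingHom L) (Matrix.of fun i j : Fin 2 => if i.val + j.val + 1 = 2 then (1 : L) else 0)
      (Matrix.of fun i j : Fin 1 => if i.val + j.val + 1 = 1 then (1 : L) else 0) γH γH')
    [∀ g : (UnitaryGroup.cmDatum L 2 (Matrix.of fun i j : Fin 2 => if i.val + j.val + 1 = 2 then (1 : L) else 0)).Adelic ×
        (UnitaryGroup.cmDatum L 1 (Matrix.of fun i j : Fin 1 => if i.val + j.val + 1 = 1 then (1 : L) else 0)).Adelic,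
      MeasurableSpace (((UnitaryGroup.cmDatum L 2 (Matrix.of fun i j : Fin 2 => if i.val + j.val + 1 = 2 then (1 : L) else 0)).Adelic ×
        (UnitaryGroup.cmDatum L 1 (Matrix.of fun i j : Fin 1 => if i.val + j.val + 1 = 1 then (1 : L) else 0)).Adelic) ⧸
        Subgroup.centralizer ({g} : Set ((UnitaryGroup.cmDatum L 2 (Matrix.of fun i j : Fin 2 => if i.val + j.val + 1 = 2 then (1 : L) else 0)).Adelic ×
          (UnitaryGroup.cmDatum L 1 (Matrix.of fun i j : Fin 1 => if i.val + j.val + 1 = 1 then (1 : L) else 0)).Adelic)))]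
    (mH : OrbitalMeasureFamily ((UnitaryGroup.cmDatum L 2 (Matrix.of fun i j : Fin 2 => if i.val + j.val + 1 = 2 then (1 : L) else 0)).Adelic ×
      (UnitaryGroup.cmDatum L 1 (Matrix.of fun i j : Fin 1 => if i.val + j.val + 1 = 1 then (1 : L) else 0)).Adelic))
    (fH : (UnitaryGroup.cmDatum L 2 (Matrix.of fun i j : Fin 2 => if i.val + j.val + 1 = 2 then (1 : L) else 0)).Adelic ×
      (UnitaryGroup.cmDatum L 1 (Matrix.of fun i j : Fin 1 => if i.val + j.val + 1 = 1 then (1 : L) else 0)).Adelic → ℂ) :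
    adelicStableOrbitalIntegralH L γH mH fH = adelicStableOrbitalIntegralH L γH' mH fH := by
  unfold adelicStableOrbitalIntegralH
  rw [adelicStableClassesOverH_eq_of_isStablyConjH L h]

end Hside

/-! ## §3 `G′`-side: `𝒞_𝐀(γ_H)` in the inner form `U(H′)` -/

section Gprime

variable (H' : Matrix (Fin 3) (Fin 3) L)

/-- Stably conjugate base points `γ_H ∼_st γ_H′` have the same norm-matching `G′`-adèles (★ `MatchingAdele`; the norm correspondences
`(γ_H)_v → γ̄_v`, `γ_H ⊗ 1 → γ̄_∞` depend only on the stable class of `γ_H`: ★ `EndoMatches.of_isStablyConjH_left`).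
[cite: Rogawski1990, §4.3 p. 43; §5.4 p. 71] -/
theorem MatchingAdele.exists_adele_eq_of_isStablyConjH
    {γH γH' : (UnitaryGroup.cmDatum L 2 (Matrix.of fun i j : Fin 2 => if i.val + j.val + 1 = 2 then (1 : L) else 0)).Rational ×
      (UnitaryGroup.cmDatum L 1 (Matrix.of fun i j : Fin 1 => if i.val + j.val + 1 = 1 then (1 : L) else 0)).Rational}
    (h : IsStablyConjH (cmConjRingHom L) (Matrix.of fun i j : Fin 2 => if i.val + j.val + 1 = 2 then (1 : L) else 0)
      (Matrix.of fun i j : Fin 1 => if i.val + j.val + 1 = 1 then (1 : L) else 0) γH γH')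
    (p : MatchingAdele L H' γH) : ∃ q : MatchingAdele L H' γH', q.adele = p.adele := by
  have h1 : ∀ v : HeightOneSpectrum (𝓞 ↥(maximalRealSubfield L)),
      IsLocalNormPair L H' v (rationalComponent L γH' v) ((UnitaryGroup.cmDatum L 3 H').toLocal v p.adele) :=
    fun v => EndoMatches.of_isStablyConjH_left (p.isLocalNormPair v) (isLocalStablyConjH_rationalComponent_of_isStablyConjH L h v)
  have h2 : IsArchNormPair L H' (rationalArch L γH') p.arch :=
    EndoMatches.of_isStablyConjH_left p.isArchNormPair (isArchStablyConjH_rationalArch_of_isStablyConjH L h)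
  -- `rfl` stated at `p.1` so that the kernel never compares `adele ⟨p.1, …⟩` with `adele p` argument-wise
  exact ⟨⟨p.1, h1, h2⟩, (rfl : p.1 = p.1)⟩

/-- **`𝒞_𝐀(γ_H) = 𝒞_𝐀(γ_H′)` in `G′(𝐀)` for `γ_H ∼_st γ_H′`** (★ `adelicStableClassesOver`). [cite: Rogawski1990, §5.4 p. 71] -/
theorem adelicStableClassesOver_eq_of_isStablyConjH
    {γH γH' : (UnitaryGroup.cmDatum L 2 (Matrix.of fun i j : Fin 2 => if i.val + j.val + 1 = 2 then (1 : L) else 0)).Rational ×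
      (UnitaryGroup.cmDatum L 1 (Matrix.of fun i j : Fin 1 => if i.val + j.val + 1 = 1 then (1 : L) else 0)).Rational}
    (h : IsStablyConjH (cmConjRingHom L) (Matrix.of fun i j : Fin 2 => if i.val + j.val + 1 = 2 then (1 : L) else 0)
      (Matrix.of fun i j : Fin 1 => if i.val + j.val + 1 = 1 then (1 : L) else 0) γH γH') :
    adelicStableClassesOver L H' γH = adelicStableClassesOver L H' γH' := by
  refine Set.ext fun c => ⟨?_, ?_⟩
  · rintro ⟨p, rfl⟩
    obtain ⟨q, hq⟩ := MatchingAdele.exists_adele_eq_of_isStablyConjH L H' h p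
    exact ⟨q, by show ConjClasses.mk q.adele = ConjClasses.mk p.adele; rw [hq]⟩
  · rintro ⟨p, rfl⟩
    obtain ⟨q, hq⟩ := MatchingAdele.exists_adele_eq_of_isStablyConjH L H' h.symm p
    exact ⟨q, by show ConjClasses.mk q.adele = ConjClasses.mk p.adele; rw [hq]⟩

/-- **`Φ^{st,𝐀}_{G′}(γ_H, m, f′) = Φ^{st,𝐀}_{G′}(γ_H′, m, f′)` for `γ_H ∼_st γ_H′`** (★ `adelicStableOrbitalIntegralG'`). [cite: Rogawski1990, §5.4 p. 71] -/
theorem adelicStableOrbitalIntegralG'_eq_of_isStablyConjH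
    {γH γH' : (UnitaryGroup.cmDatum L 2 (Matrix.of fun i j : Fin 2 => if i.val + j.val + 1 = 2 then (1 : L) else 0)).Rational ×
      (UnitaryGroup.cmDatum L 1 (Matrix.of fun i j : Fin 1 => if i.val + j.val + 1 = 1 then (1 : L) else 0)).Rational}
    (h : IsStablyConjH (cmConjRingHom L) (Matrix.of fun i j : Fin 2 => if i.val + j.val + 1 = 2 then (1 : L) else 0)
      (Matrix.of fun i j : Fin 1 => if i.val + j.val + 1 = 1 then (1 : L) else 0) γH γH')
    [∀ g : (UnitaryGroup.cmDatum L 3 H').Adelic,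
      MeasurableSpace ((UnitaryGroup.cmDatum L 3 H').Adelic ⧸ Subgroup.centralizer ({g} : Set (UnitaryGroup.cmDatum L 3 H').Adelic))]
    (m : OrbitalMeasureFamily (UnitaryGroup.cmDatum L 3 H').Adelic) (f : (UnitaryGroup.cmDatum L 3 H').Adelic → ℂ) :
    adelicStableOrbitalIntegralG' L H' γH m f = adelicStableOrbitalIntegralG' L H' γH' m f := by
  unfold adelicStableOrbitalIntegralG'
  rw [adelicStableClassesOver_eq_of_isStablyConjH L H' h]

end Gprime

end Literature.NumberTheory.Rogawski1990

end
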